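import Summits.Ventures.DiscreteObjects.UnitDistance.FiniteFieldLowerBoundF19Data
import HarnessLib

/-!
# `UD(F₁₉²)` is not 4-colourable — kernel search, piece 2 of 12 (the subtree below `ud19Q2`)

Framing (verbatim for the cell): lottery ticket; floor = certified bounds/negative ranges.

The subtree of the colouring search (`KernelColouringSearch.lean`: bit-vector states, unit propagation, PASS branching) below the depth-3
state `ud19Q2` of `FiniteFieldLowerBoundF19Data.lean`, cut once more into 2 sub-states `ud19R2x1, ud19R2x2` (depth 4–5, each ≤ 0.7·10⁶
bit-vector operations so that one kernel evaluation stays within memory): each sub-state is refuted by `decide +kernel`, then `ud19Q2` is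
refuted by the search with those sub-states as its `done` list, and `ud19_piece2` packages the logical statement used by
`FiniteFieldLowerBoundF19.lean`: no proper 4-colouring is consistent with `ud19Q2`.
-/

namespace Summit.Ventures.DiscreteObjects.UnitDistance

open KBits

/-- Search state after the branches `1 ↦ 1 → 43 ↦ 0 → 112 ↦ 3 → 70 ↦ 0` (vertex ↦ colour, each followed by unit propagation). -/
def ud19R2x1 : ℕ × ℕ × ℕ × ℕ × ℕ :=
  (3174192563017606797396108075154335180894974568598342604510372626972134054407051440238284116601941358451883453,
   4403354888476495349634585599714636634589156965796954147984121884239018829147397040492797978921644986809188346,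
   4697085165547666455778961193578674054751365097816639741414581943064418050229216886927397996769537406063345662,
   4697084885545397890978700312580068629328866521370423077836350489238525199244352531066634334102703618221670396,
   4697085165547666455778961193578674054751365097816639741414581943064418050224024590068861988549377396229799932)

/-- Search state after the branches `1 ↦ 1 → 43 ↦ 0 → 112 ↦ 3 → 70 ↦ 2` (vertex ↦ colour, each followed by unit propagation). -/
def ud19R2x2 : ℕ × ℕ × ℕ × ℕ × ℕ :=
  (3486108374792256527112909043844843867576087711811229199851314252052028780407728478138714586630758235393752573,
   4403354888476495349634585599714636634589156965796954147984121884239018829147397040492797978921644986809188346,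
   4385169353773016726062160224888165368070251954603753146073640317984523324223347552168432108816379674086604732,
   4697084885545397890978700312580068629328866521370423077836350489238525199244352531066634334102703618221670396,
   4697085165547666455778961193578674054751365097816639741414581943064418050224024590068861988549377396229799932)

set_option maxHeartbeats 400000000 in
set_option maxRecDepth 200000 in
/-- KERNEL FACT: the search refutes every 4-colouring below `ud19R2x1`. -/
theorem ud19R2x1_run : search ud19nb 361 40 [] 361 ud19R2x1 = true := by
  decide +kernel

set_option maxHeartbeats 400000000 in
set_option maxRecDepth 200000 in
/-- KERNEL FACT: the search refutes every 4-colouring below `ud19R2x2`. -/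
theorem ud19R2x2_run : search ud19nb 361 40 [] 361 ud19R2x2 = true := by
  decide +kernel

set_option maxHeartbeats 400000000 in
set_option maxRecDepth 200000 in
/-- KERNEL FACT: below `ud19Q2` every branch dies or reaches one of the refuted sub-states. -/
theorem ud19Q2_run : search ud19nb 361 40 [ud19R2x1, ud19R2x2] 361 ud19Q2 = true := by
  decide +kernel

/-- PIECE 2: no proper 4-colouring (for the neighbourhood words `ud19nb`) is consistent with the state `ud19Q2`. -/
theorem ud19_piece2 {col : ℕ → ℕ} (hP : Proper ud19nb 361 col) :
    UBound 361 ud19Q2 → Cons 361 col ud19Q2 → False := by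
  refine search_sound hP (done := [ud19R2x1, ud19R2x2]) ?_ 361 _ ud19Q2_run
  intro d hd
  simp only [List.mem_cons, List.not_mem_nil, or_false] at hd
  rcases hd with rfl | rfl
  · exact search_sound hP (done := []) (by simp) 361 _ ud19R2x1_run
  · exact search_sound hP (done := []) (by simp) 361 _ ud19R2x2_run

end Summit.Ventures.DiscreteObjects.UnitDistance
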